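import Summits.Ventures.PercRepro.PuncturedLYMChainNeg2

/-!
# PercRepro — (SP) BY SUPERPOSITION, PART 12: (SP) FROM TWO CERTIFICATES — THE PROFILE AND THE WORDS THROUGH A POINT
(p10, gen 31)

The re-routing decrease at a completion `X ↦ insert y X` from a near word `B` (`X = (B ∖ b) ∪ x`) is at most
`errE(x)⁺/j` when `y = b` and at most `errE(x)⁻/j` when `y ≠ b` (`reroute_ge2`); at most ONE near word has `b = y` (two
would be two code words inside `X ∪ {y}`), so `Σ_B reroute ≥ −(M⁺ + (j − 1)·M⁻)/j` (`sum_reroute_ge2`) whenever `M⁺`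
bounds the positive errors and `M⁻` the negative ones.  With the profile certificate `λ` (PuncturedLYMChain:
`errE⁺ ≤ Σ_{a<j−1} λ_a s_a/(n−j)`) and the through-point certificate `μ` (PuncturedLYMChainNeg:
`errE⁻ ≤ Σ_{a<j−1} μ_a s'_a/(n−j)`):
* **`puncturedNMP_of_cert2`** — (SP) for every code on `(n, j)` with
  `Σ_{a<j} λ_a s_a + (Σ_{a<j−1} λ_a s_a + (j − 1)·Σ_{a<j−1} μ_a s'_a)/j ≤ 1` (`2 ≤ j`, `2j + 1 ≤ n`).
Nothing here asserts (SP) in general.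
-/

namespace PercRepro.PuncturedLYM

open Finset

variable {α : Type} [Fintype α] [DecidableEq α]

/-- **The two-sided lower bound for the correction**: for `X` a `j`-set near `B` with `X ∖ B = {x}`, `B ∖ X = {b}` and
`y ∉ X`: `reroute ≥ −errE(x)⁺/j` if `y = b`, and `reroute ≥ −errE(x)⁻/j` if `y ≠ b`. -/
theorem reroute_ge2 {j : ℕ} (D : Finset (Finset α)) {B X : Finset α} (hn : (X ∩ B).card + 1 = j) {x b : α}
    (hx : X \ B = {x}) (hb : B \ X = {b}) {y : α} (hy : y ∉ X) :
    reroute α j D B X y ≥ (if y = b then - max (errE α j D B x) 0 else - max (- errE α j D B x) 0) / j := by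
  have hxB : x ∉ B := (mem_sdiff.1 (hx ▸ mem_singleton_self x)).2
  rw [reroute_near D hn hx hb y]
  have hj0 : 0 < j := by omega
  have hjpos : (0 : ℚ) < j := by exact_mod_cast hj0
  have hjinv : (0 : ℚ) ≤ 1 / j := by positivity
  split_ifs with hyb
  · have h1 : - max (errE α j D B x) 0 ≤ - errE α j D B x := by
      have := le_max_left (errE α j D B x) 0
      linarith
    calc - max (errE α j D B x) 0 / j = 1 / (j : ℚ) * (- max (errE α j D B x) 0) := by ring
      _ ≤ 1 / (j : ℚ) * (- errE α j D B x) := mul_le_mul_of_nonneg_left h1 hjinv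
  · have hyB : y ∉ B := by
      intro hyB
      have : y ∈ B \ X := mem_sdiff.2 ⟨hyB, hy⟩
      rw [hb, mem_singleton] at this
      exact hyb this
    have hA : 0 ≤ max (errE α j D B x) 0 * max (- errE α j D B y) 0 :=
      mul_nonneg (le_max_right _ _) (le_max_right _ _)
    have hy' := max_errE_le_errPos (j := j) D hyB
    have hC0 := le_max_right (- errE α j D B x) 0
    have h1 : - max (- errE α j D B x) 0 ≤
        (max (errE α j D B x) 0 * max (- errE α j D B y) 0 - max (- errE α j D B x) 0 * max (errE α j D B y) 0) /
          errPos α j D B := by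
      by_cases hS : errPos α j D B = 0
      · rw [hS, div_zero]
        linarith
      · have hSpos : 0 < errPos α j D B :=
          lt_of_le_of_ne (sum_nonneg (fun z _ => le_max_right _ _)) (Ne.symm hS)
        rw [le_div_iff₀ hSpos]
        have : max (- errE α j D B x) 0 * max (errE α j D B y) 0 ≤ max (- errE α j D B x) 0 * errPos α j D B :=
          mul_le_mul_of_nonneg_left hy' hC0
        linarith
    calc - max (- errE α j D B x) 0 / j = 1 / (j : ℚ) * (- max (- errE α j D B x) 0) := by ring
      _ ≤ 1 / (j : ℚ) * ((max (errE α j D B x) 0 * max (- errE α j D B y) 0 -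
          max (- errE α j D B x) 0 * max (errE α j D B y) 0) / errPos α j D B) := mul_le_mul_of_nonneg_left h1 hjinv

omit [Fintype α] in
/-- At most one word near `X` has its outside point equal to `y` (`y ∉ X`): two such words would be two code words inside
`insert y X`. -/
theorem card_near_at_le_one {j : ℕ} {D : Finset (Finset α)} (hD : IsCode j D) {X : Finset α} (hX : X.card = j)
    {y : α} (hy : y ∉ X) :
    (D.filter (fun B => (X ∩ B).card + 1 = j ∧ y ∈ B)).card ≤ 1 := by
  rw [card_le_one]
  intro B hB B' hB'
  rw [mem_filter] at hB hB'
  have hBY : B ⊆ insert y X := by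
    intro w hw
    by_cases hwX : w ∈ X
    · exact mem_insert_of_mem hwX
    · -- `w ∈ B ∖ X`, a single point, which is `y` (`y ∈ B ∖ X`)
      obtain ⟨⟨x, hx⟩, ⟨b, hb⟩⟩ := near_sdiff hX (hD.1 B hB.1) hB.2.1
      have h1 : w ∈ B \ X := mem_sdiff.2 ⟨hw, hwX⟩
      have h2 : y ∈ B \ X := mem_sdiff.2 ⟨hB.2.2, hy⟩
      rw [hb, mem_singleton] at h1 h2
      rw [h1, ← h2]
      exact mem_insert_self _ _
  have hB'Y : B' ⊆ insert y X := by
    intro w hw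
    by_cases hwX : w ∈ X
    · exact mem_insert_of_mem hwX
    · obtain ⟨⟨x, hx⟩, ⟨b, hb⟩⟩ := near_sdiff hX (hD.1 B' hB'.1) hB'.2.1
      have h1 : w ∈ B' \ X := mem_sdiff.2 ⟨hw, hwX⟩
      have h2 : y ∈ B' \ X := mem_sdiff.2 ⟨hB'.2.2, hy⟩
      rw [hb, mem_singleton] at h1 h2
      rw [h1, ← h2]
      exact mem_insert_self _ _
  exact code_unique_of_subset hD hB.1 hB'.1 (by rw [card_insert_of_notMem hy, hX]) hBY hB'Y

/-- **The total correction is at least `−(max M⁺ M⁻ + (j − 1)·M⁻)/j`** when `M⁺ ≥ 0` bounds every positive error and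
`M⁻ ≥ 0` every negative error (`X` a `j`-set, `y ∉ X`, `j < n`): at most one near word has `b = y`. -/
theorem sum_reroute_ge2 {j : ℕ} {D : Finset (Finset α)} (hD : IsCode j D) (hjn : j < Fintype.card α) {Mp Mm : ℚ}
    (hMp0 : 0 ≤ Mp) (hMm0 : 0 ≤ Mm) (hMp : ∀ B ∈ D, ∀ x ∉ B, max (errE α j D B x) 0 ≤ Mp)
    (hMm : ∀ B ∈ D, ∀ x ∉ B, max (- errE α j D B x) 0 ≤ Mm) {X : Finset α} (hX : X.card = j) {y : α} (hy : y ∉ X) :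
    - (max Mp Mm + ((j : ℚ) - 1) * Mm) / j ≤ ∑ B ∈ D, reroute α j D B X y := by
  rcases Nat.eq_zero_or_pos j with hj0 | hjpos
  · subst hj0
    simp only [CharP.cast_eq_zero, div_zero]
    apply sum_nonneg
    intro B hB
    rw [reroute_of_not_near 0 D B X y (by omega)]
  have hjq : (0 : ℚ) < j := by exact_mod_cast hjpos
  -- split the near words into those with `b = y` (at most one) and the others
  set N := D.filter (fun B => (X ∩ B).card + 1 = j) with hN
  rw [← sum_filter_add_sum_filter_not D (fun B => (X ∩ B).card + 1 = j)]
  have h0 : ∑ B ∈ D.filter (fun B => ¬ (X ∩ B).card + 1 = j), reroute α j D B X y = 0 := by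
    apply sum_eq_zero
    intro B hB
    exact reroute_of_not_near j D B X y (mem_filter.1 hB).2
  rw [h0, add_zero, ← sum_filter_add_sum_filter_not N (fun B => y ∈ B)]
  -- the `y ∈ B` part: at most one word, each `≥ −Mp/j`
  have h1 : ∑ B ∈ N.filter (fun B => y ∈ B), reroute α j D B X y ≥ ∑ B ∈ N.filter (fun B => y ∈ B), (- Mp / j) := by
    apply sum_le_sum
    intro B hB
    rw [hN, mem_filter, mem_filter] at hB
    obtain ⟨⟨x, hx⟩, ⟨b, hb⟩⟩ := near_sdiff hX (hD.1 B hB.1.1) hB.1.2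
    have hxB : x ∉ B := (mem_sdiff.1 (hx ▸ mem_singleton_self x)).2
    have hyb : y = b := by
      have : y ∈ B \ X := mem_sdiff.2 ⟨hB.2, hy⟩
      rw [hb, mem_singleton] at this
      exact this
    have := reroute_ge2 D hB.1.2 hx hb hy
    rw [if_pos hyb] at this
    have hM := hMp B hB.1.1 x hxB
    calc - Mp / j ≤ - max (errE α j D B x) 0 / j := by
          apply div_le_div_of_nonneg_right _ hjq.le
          linarith
      _ ≤ reroute α j D B X y := this
  have h2 : ∑ B ∈ N.filter (fun B => ¬ y ∈ B), reroute α j D B X y ≥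
      ∑ B ∈ N.filter (fun B => ¬ y ∈ B), (- Mm / j) := by
    apply sum_le_sum
    intro B hB
    rw [hN, mem_filter, mem_filter] at hB
    obtain ⟨⟨x, hx⟩, ⟨b, hb⟩⟩ := near_sdiff hX (hD.1 B hB.1.1) hB.1.2
    have hxB : x ∉ B := (mem_sdiff.1 (hx ▸ mem_singleton_self x)).2
    have hyb : y ≠ b := by
      intro h
      exact hB.2 (h ▸ (mem_sdiff.1 (hb ▸ mem_singleton_self b)).1)
    have := reroute_ge2 D hB.1.2 hx hb hy
    rw [if_neg hyb] at this
    have hM := hMm B hB.1.1 x hxB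
    calc - Mm / j ≤ - max (- errE α j D B x) 0 / j := by
          apply div_le_div_of_nonneg_right _ hjq.le
          linarith
      _ ≤ reroute α j D B X y := this
  rw [sum_const, nsmul_eq_mul] at h1
  rw [sum_const, nsmul_eq_mul] at h2
  -- the counts: `≤ 1` and `≤ j − 1`... (the total number of near words is `≤ j`, and the two parts are disjoint)
  have hc1 : (N.filter (fun B => y ∈ B)).card ≤ 1 := by
    rw [hN, filter_filter]
    exact card_near_at_le_one hD hX hy
  have hcN : N.card ≤ j := by rw [hN]; exact card_near_le hD hX
  have hc2 : (N.filter (fun B => ¬ y ∈ B)).card ≤ j := le_trans (card_filter_le _ _) hcN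
  have hc12 : (N.filter (fun B => y ∈ B)).card + (N.filter (fun B => ¬ y ∈ B)).card = N.card :=
    card_filter_add_card_filter_not (fun B => y ∈ B) (s := N)
  -- bound: `c₁·(−Mp/j) + c₂·(−Mm/j) ≥ −(Mp + (j−1)Mm)/j` when `c₁ ≤ 1`, `c₁ + c₂ ≤ j`
  have hc1q : ((N.filter (fun B => y ∈ B)).card : ℚ) ≤ 1 := by exact_mod_cast hc1
  have hc2q : ((N.filter (fun B => y ∈ B)).card : ℚ) + (N.filter (fun B => ¬ y ∈ B)).card ≤ j := by
    have : (N.filter (fun B => y ∈ B)).card + (N.filter (fun B => ¬ y ∈ B)).card ≤ j := hc12 ▸ hcN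
    exact_mod_cast this
  have hMpj : 0 ≤ Mp / j := div_nonneg hMp0 hjq.le
  have hMmj : 0 ≤ Mm / j := div_nonneg hMm0 hjq.le
  -- `c₁·(−Mp/j) + c₂·(−Mm/j) ≥ −(Mp + (j − 1)·Mm)/j`: `c₁ ≤ 1`, `c₁ + c₂ ≤ j`, `c₂ ≤ j − c₁ ≤ j − 1 + (1 − c₁)`
  set c₁ : ℚ := ((N.filter (fun B => y ∈ B)).card : ℚ) with hc₁
  set c₂ : ℚ := ((N.filter (fun B => ¬ y ∈ B)).card : ℚ) with hc₂
  have hc₁0 : 0 ≤ c₁ := by positivity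
  have hc₂0 : 0 ≤ c₂ := by positivity
  -- `c₁ Mp + c₂ Mm ≤ Mp + (j − 1) Mm`: since `c₂ ≤ j − c₁`, `c₂ Mm ≤ (j − c₁) Mm = (j − 1) Mm + (1 − c₁) Mm`, and
  -- `(1 − c₁)(Mm − Mp)` … use `c₁ ∈ {0, 1}`
  have hkey : c₁ * Mp + c₂ * Mm ≤ max Mp Mm + ((j : ℚ) - 1) * Mm := by
    have hmax1 := le_max_left Mp Mm
    have hmax2 := le_max_right Mp Mm
    rcases Nat.eq_zero_or_pos (N.filter (fun B => y ∈ B)).card with hz | hz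
    · have hc₁z : c₁ = 0 := by rw [hc₁, hz]; simp
      rw [hc₁z] at hc2q ⊢
      have : c₂ * Mm ≤ (j : ℚ) * Mm := mul_le_mul_of_nonneg_right (by linarith) hMm0
      nlinarith
    · have hc₁e : c₁ = 1 := by
        have : (N.filter (fun B => y ∈ B)).card = 1 := by omega
        rw [hc₁, this]
        simp
      rw [hc₁e] at hc2q ⊢
      have : c₂ * Mm ≤ ((j : ℚ) - 1) * Mm := mul_le_mul_of_nonneg_right (by linarith) hMm0
      linarith
  have e1 : c₁ * (- Mp / j) + c₂ * (- Mm / j) = - (c₁ * Mp + c₂ * Mm) / j := by ring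
  have e2 : - (max Mp Mm + ((j : ℚ) - 1) * Mm) / j ≤ - (c₁ * Mp + c₂ * Mm) / j := by
    rw [div_le_div_iff_of_pos_right hjq]
    linarith
  linarith [e1, e2, h1, h2]

/-- **(SP) from two certificates** (`2 ≤ j`, `2j + 1 ≤ n`): `λ ≥ 0` with `e(a) ≤ (j − a)λ_a + aλ_{a−1}` (the profile) and
`μ ≥ 0` with `g(a) ≤ (j − 1 − a)μ_a + aμ_{a−1}` (the words through a point), such that
`Σ_{a<j} λ_a s_a + (max (Σ_{a<j−1} λ_a s_a) (Σ_{a<j−1} μ_a s'_a) + (j − 1)·Σ_{a<j−1} μ_a s'_a)/j ≤ 1`. -/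
theorem puncturedNMP_of_cert2 {j : ℕ} {D : Finset (Finset α)} (hD : IsCode j D) (hj : 2 ≤ j)
    (hn : 2 * j + 1 ≤ Fintype.card α) (lam mu : ℕ → ℚ) (hlam : ∀ a, a < j → 0 ≤ lam a)
    (hcert : ∀ a, a < j → eDef α j a ≤ ((j : ℚ) - a) * lam a + (a : ℚ) * lam (a - 1))
    (hmu : ∀ a, a + 2 ≤ j → 0 ≤ mu a)
    (hcertm : ∀ a, a + 2 ≤ j → gDef α j a ≤ ((j : ℚ) - 1 - a) * mu a + (a : ℚ) * mu (a - 1))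
    (hbound : ∑ a ∈ range j, lam a * sQ α j a +
      (max (∑ a ∈ range (j - 1), lam a * sQ α j a) (∑ a ∈ range (j - 1), mu a * sQ' α j a) +
        ((j : ℚ) - 1) * ∑ a ∈ range (j - 1), mu a * sQ' α j a) / j ≤ 1) :
    PuncturedNMP j D := by
  have hjn : j < Fintype.card α := by omega
  have hj0 : 0 < j := by omega
  have hj1 : 1 ≤ j := by omega
  have hn2 : 2 * j ≤ Fintype.card α := by omega
  have hnj : (0 : ℚ) < (Fintype.card α : ℚ) - j := by
    have : (j : ℚ) < Fintype.card α := by exact_mod_cast hjn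
    linarith
  have hjq : (0 : ℚ) < j := by exact_mod_cast hj0
  set NX : ℚ := ∑ a ∈ range j, lam a * sQ α j a with hNX
  set NB : ℚ := ∑ a ∈ range (j - 1), lam a * sQ α j a with hNB
  set Q : ℚ := ∑ a ∈ range (j - 1), mu a * sQ' α j a with hQ
  have hNB0 : 0 ≤ NB := sum_nonneg (fun a ha => mul_nonneg (hlam a (by have := mem_range.1 ha; omega)) (by unfold sQ; positivity))
  have hQ0 : 0 ≤ Q := sum_nonneg (fun a ha => mul_nonneg (hmu a (by have := mem_range.1 ha; omega)) (by unfold sQ'; positivity))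
  set Mp : ℚ := NB / ((Fintype.card α : ℚ) - j) with hMp_def
  set Mm : ℚ := Q / ((Fintype.card α : ℚ) - j) with hMm_def
  have hMp0 : 0 ≤ Mp := div_nonneg hNB0 hnj.le
  have hMm0 : 0 ≤ Mm := div_nonneg hQ0 hnj.le
  have hMp : ∀ B ∈ D, ∀ x ∉ B, max (errE α j D B x) 0 ≤ Mp := by
    intro B hB x _
    calc max (errE α j D B x) 0
        ≤ (∑ B' ∈ D.erase B, eDef α j (B ∩ B').card) / ((Fintype.card α : ℚ) - j) := max_errE_le hD hn2 hjn hB x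
      _ ≤ Mp := by
          rw [hMp_def]
          apply div_le_div_of_nonneg_right _ hnj.le
          apply sum_eDef_le_of_cert_of_no_near (isCode_erase hD B) hj (hD.1 B hB) (notMem_erase B D) _ lam hlam hcert
          intro B' hB'
          have hne : B ≠ B' := (ne_of_mem_erase hB').symm
          have := hD.2 B hB B' (mem_of_mem_erase hB') hne
          omega
  have hMm : ∀ B ∈ D, ∀ x ∉ B, max (- errE α j D B x) 0 ≤ Mm := by
    intro B hB x hx
    calc max (- errE α j D B x) 0
        ≤ (∑ B' ∈ (D.erase B).filter (fun B' => x ∈ B'), gDef α j (B ∩ B').card) / ((Fintype.card α : ℚ) - j) :=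
          max_neg_errE_le hD hn2 hjn hB x
      _ ≤ Mm := by
          rw [hMm_def]
          apply div_le_div_of_nonneg_right _ hnj.le
          exact sum_gDef_through_le_of_cert hD hj hB hx mu hmu hcertm
  set c : ℚ := ((punctured j D).card : ℚ) / (levelAbove α j).card with hc_def
  have hc0 : 0 ≤ c := by positivity
  refine puncturedNMP_of_weights (fun X Y => totalWp α j D X Y / c) ?_ ?_ ?_
  · intro X hX Y hY
    obtain ⟨hXc, hXD⟩ := mem_punctured.1 hX
    rw [sups_eq hXc] at hY
    obtain ⟨y, hy, rfl⟩ := mem_image.1 hY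
    rw [totalWp_insert j D X (mem_sdiff.1 hy).2]
    apply div_nonneg _ hc0
    have h1 := superW_ge hD hn2 hjn X y
    have h2 := sum_reroute_ge2 hD hjn hMp0 hMm0 hMp hMm hXc (mem_sdiff.1 hy).2
    have hN := sum_eDef_le_of_cert hD hj1 hXc hXD lam hlam hcert
    unfold totalW
    -- `(1 − N)/(n−j) − (Mp + (j−1) Mm)/j ≥ (1 − NX − (NB + (j−1) Q)/j)/(n−j) ≥ 0`
    have hkey : 0 ≤ (1 - ∑ B ∈ D, eDef α j (X ∩ B).card) / ((Fintype.card α : ℚ) - j) -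
        (max Mp Mm + ((j : ℚ) - 1) * Mm) / j := by
      have hmaxdiv : max Mp Mm = max NB Q / ((Fintype.card α : ℚ) - j) := by
        rw [hMp_def, hMm_def]
        rcases le_total NB Q with h | h
        · rw [max_eq_right h, max_eq_right (div_le_div_of_nonneg_right h hnj.le)]
        · rw [max_eq_left h, max_eq_left (div_le_div_of_nonneg_right h hnj.le)]
      rw [hmaxdiv, hMm_def]
      have e : (max NB Q / ((Fintype.card α : ℚ) - j) + ((j : ℚ) - 1) * (Q / ((Fintype.card α : ℚ) - j))) / j =
          ((max NB Q + ((j : ℚ) - 1) * Q) / j) / ((Fintype.card α : ℚ) - j) := by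
        field_simp
      rw [e, ← sub_div]
      apply div_nonneg _ hnj.le
      linarith
    rw [neg_div] at h2
    linarith
  · intro X hX
    rw [← sum_div, sum_sups_totalWp hD hjn hX, hc_def, one_div_div]
  · intro Y hY
    rw [← sum_div, sum_subsP_totalWp hD hj0 hjn (mem_levelAbove.1 hY), ← hc_def]
    rcases eq_or_ne c 0 with hc | hc
    · rw [hc, div_zero]
      exact zero_le_one
    · rw [div_self hc]

end PercRepro.PuncturedLYM
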